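import Summits.KontsevichZagierPeriods.KontsevichZagierPeriods.Theses.FermatIsogeny

/-!
# Route KontsevichZagierPeriods/FermatIsogeny — `Assembly`: the route's cruxes imply the summit

Problem `KontsevichZagierPeriods`, route `FermatIsogeny`, item stmt-KontsevichZagierPeriods-14251
(`Assembly`, assembly, rank 1). The route declaration `Assembly` is the curried implication
`BetaLinearSector → BetaProductSector → FermatSectorComplete → KontsevichZagierPeriods`.

The proof is lattice bookkeeping over the Kontsevich–Zagier calculus of moves
(`Literature.NumberTheory.Transcendental.KZCalculus`):
* the summit `KontsevichZagierPeriods` (= `Literature.Periods.KZPeriodConjecture`) asks, for two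
  rational-shape representations `r, r'` with `r.value = r'.value`, that `KZ.Equivalent r r'`, i.e.
  `[r] - [r'] ∈ KZ.relations`;
* the crux `FermatSectorComplete` (relative completeness modulo the beta sector) puts `[r] - [r']`
  in `KZ.relations ⊔ AddSubgroup.closure (S_lin ∪ S_prod)`, where `S_lin` / `S_prod` are the formal
  differences `[ρ] - [ρ']` of the hypothesis pairs of `BetaLinearSector` / `BetaProductSector`
  (inlined in the route declaration);
* the sector cruxes `BetaLinearSector` and `BetaProductSector` say precisely that every generator
  of `S_lin ∪ S_prod` lies in `KZ.relations` (`KZ.Equivalent ρ ρ'` unfolds to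
  `[ρ] - [ρ'] ∈ KZ.relations`), hence `AddSubgroup.closure (S_lin ∪ S_prod) ≤ KZ.relations`
  (`AddSubgroup.closure_le`) and the sup collapses to `KZ.relations` (`sup_le le_rfl _`).

The term is the same as the route's deciding theorem `FermatIsogeny.closes`, re-proved here
self-containedly so that the item is closed by a `Theorems` declaration whose type is literally
the route declaration.

Sources: M. Kontsevich, D. Zagier, *Periods* (2001), §1.2 (Conjecture 1, rules 1–3);
A. Huber, S. Müller-Stach, *Periods and Nori Motives* (2017), §13.1.
Deliberately NOT here: any claim about the three hypotheses themselves — the result is the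
implication only (unconditional as an implication; all three antecedents are OPEN route cruxes,
`FermatSectorComplete` being of period-conjecture strength).
-/

namespace Summit.KontsevichZagierPeriods.FermatIsogeny

open Summit.KontsevichZagierPeriods.KontsevichZagierPeriods.Theses.FermatIsogeny

/-- **Assembly of route FermatIsogeny** (settles stmt-KontsevichZagierPeriods-14251): the route
declaration `FermatIsogeny.Assembly`
(`BetaLinearSector → BetaProductSector → FermatSectorComplete → KontsevichZagierPeriods`) holds.
For rational representations `r, r'` with equal values, `FermatSectorComplete` puts `[r] - [r']`
in `KZ.relations ⊔ AddSubgroup.closure (S_lin ∪ S_prod)`; `BetaLinearSector` and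
`BetaProductSector` give `S_lin ∪ S_prod ⊆ KZ.relations` generator by generator, so
`AddSubgroup.closure (S_lin ∪ S_prod) ≤ KZ.relations`, the sup is `KZ.relations`, and
`[r] - [r'] ∈ KZ.relations`, i.e. `KZ.Equivalent r r'`. [Kontsevich–Zagier 2001, §1.2]
[folklore] -/
theorem assembly_proof :
    Summit.KontsevichZagierPeriods.KontsevichZagierPeriods.Theses.FermatIsogeny.Assembly := by
  unfold Summit.KontsevichZagierPeriods.KontsevichZagierPeriods.Theses.FermatIsogeny.Assembly
  intro h₃ h₄ h₅ n m r r' hr hr' hv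
  -- it suffices that `closure (S_lin ∪ S_prod) ≤ relations`, i.e. `S_lin ∪ S_prod ⊆ relations`
  refine (sup_le le_rfl ((AddSubgroup.closure_le _).mpr ?_)) (h₅ r r' hr hr' hv)
  -- which is exactly the two sector cruxes, generator by generator
  rintro z (⟨a, b, a', b', c, ρ, ρ', ha, hb, ha', hb', hc, hd, hi, hd', hi', hval, rfl⟩ |
    ⟨a, b, e, d, a', b', e', d', q, ρ, ρ', ha, hb, he, hdd, ha', hb', he', hd'', hq, hd, hi, hd',
      hi', hval, rfl⟩)
  · exact h₃ a b a' b' c ha hb ha' hb' hc ρ ρ' hd hi hd' hi' hval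
  · exact h₄ a b e d a' b' e' d' q ha hb he hdd ha' hb' he' hd'' hq ρ ρ' hd hi hd' hi' hval

end Summit.KontsevichZagierPeriods.FermatIsogeny
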